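import Summits.ResolutionOfSingularities.ResolutionOfSingularities.Theorems.FrobeniusClosingPatchingRelPerfectDepthFlagCascadeCompanion
import HarnessLib

/-!
# Crux `PatchingRelPerfect` (stmt-ResolutionOfSingularities-16161), chain W5.2 — T6-E1b residual, the COMPANION CASCADE
# (res-L1-w52-idea-1's card C, Sketch v9 §4/§5): Σ-permissible sequences, the CHILD cascade, stage data, `CompanionDescent`

[OURS · L1 W5.2] NOT statements of the manuscript under review (Hironaka 2017); AI-typed, weaker than expert review.
PROVENANCE: the declarations of this module are res-L1-w52-idea-1's `L/res-L1-w52-idea-1/Sketch-L1-idea-1-v9.lean`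
(sha16 e94662fbcf7339d9, gen 7, farm rc 0) §4, §5 VERBATIM (module 2 of 2; §1/§3 = `…DepthFlagCascadeCompanion`) (docstrings included), moved from the Sketch namespace
`…Cruxes.PatchingRelPerfect.SketchL1Idea1G7b` to `…Theorems.DepthCascade` so that D-hands can land the companion descent and the
`Cascade₂` closer against them (the ideator seat cannot propose under `Theorems`, `perm.theorems-prover-only`; filer res-D-pv-054,
as res-type-003 filed the TARGETS module p529765).  FACT-FREE: F-33 (`CossartPiltant2008_prop44`, [CoP1] Prop. 4.4 — NOT an
admissible premise of this chain) occurs only as the explicit hypothesis of `prop44From_of_prop44` / inside the parameterised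
Prop `Prop44From`, and as the intended CONDITIONAL binder of `CompanionDescent`'s closer (module `…DepthFlagCascadeDescent`).

CONTENTS (idea-1's one-paragraph idea: the depth-`ℓ` E-side flag is ONE marked ideal, the BGMW sum; on a regular excellent
THREEFOLD every «simple» step of the Encinas–Villamayor companion induction is discharged by [CoP1] Prop. 4.4 instead of a
hypersurface of maximal contact): §1 pointwise order algebra; §3 the companion `O_μ = (J, μ) + (D, N-μ)`, its support, the
cascade invariant `NoStratumAbove` (`INV(μ)`), the order bounds, transform compatibility; §4 Σ-permissible sequences, `Prop44From`,
the CHILD cascade `exists_childCascade` (PROVED for every marking `N ≥ 1` modulo `Prop44From N`); §5 stage data, the TARGET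
`CompanionDescent` (one `μ`-step) and its ITERATION `companionCascade_of_descent` (PROVED).

## References
* V. Cossart, O. Piltant, J. Algebra 320 (2008), Prop. 4.2, Prop. 4.4. [CossartPiltant2008]
* E. Bierstone, D. Grigoriev, P. Milman, J. Włodarczyk (2011), §3.1, §3.7, Lemma 3.7.1. [BierstoneGrigorievMilmanWlodarczyk2011]
* S. Encinas, O. Villamayor, *A course on constructive desingularization and equivariance* (2000) (the companion / basic objects).
  [EncinasVillamayor2000]
* J. Kollár, *Lectures on Resolution of Singularities* (2007), 3.111 Step 3. [Kollar2007]
-/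

-- `Summit.<Summit>.<Sub>.Theorems` with `Sub = Summit` (single-conjunct summit, D-0017)
set_option linter.dupNamespace false

noncomputable section

open CategoryTheory CategoryTheory.Limits AlgebraicGeometry TopologicalSpace IsLocalRing
open Literature.AlgebraicGeometry.Resolution

namespace Summit.ResolutionOfSingularities.ResolutionOfSingularities.Theorems

universe u

namespace DepthCascade

open Scheme.IdealSheafData

variable {X : Scheme.{u}}

/-! ## §4 Σ-permissible sequences and the CHILD cascade for every marking `N` (C5-A with `2 ↦ N`) -/

/-- [OURS · L1 W5.2] **Σ-permissible sequences** for the marking `N`: blowing ups along regular integral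
centres inside `Sing(K, N) = {ord ≥ N}` of the current transform, `K' := 𝓘_exc^{-N} K𝒪`
([CoP1] p. 8 «`Y ⊆ Σ`»; = the X-side weight-`ℓ` permissibility read on `E`).  Copied from Sketch v4.
NOT a statement of the manuscript. [conjecture] -/
inductive IsSingPermissibleSeq :
    ∀ {X' X : Scheme.{u}}, (X' ⟶ X) → X.IdealSheafData → ℕ → X'.IdealSheafData → Prop
  /-- the empty sequence -/
  | nil {X : Scheme.{u}} (K : X.IdealSheafData) (N : ℕ) : IsSingPermissibleSeq (𝟙 X) K N K
  /-- one more blowing up along a regular integral centre inside `{ord ≥ N}` -/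
  | cons {X'' X' X : Scheme.{u}} (τ : X'' ⟶ X') (π : X' ⟶ X) (K : X.IdealSheafData) (N : ℕ)
      (K' : X'.IdealSheafData) (Y : Closeds X') :
      IsSingPermissibleSeq π K N K' →
      IsIntegral (vanishingIdeal Y).subscheme →
      Scheme.IsRegular (vanishingIdeal Y).subscheme →
      (∀ y ∈ (Y : Set X'), (N : ℕ∞) ≤ idealOrder K' y) →
      IsBlowup τ (vanishingIdeal Y) →
      IsSingPermissibleSeq (τ ≫ π) K N (controlledTransform τ (vanishingIdeal Y) K' N)

/-- **Composition of Σ-permissible sequences.** PROVED. [folklore] -/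
theorem IsSingPermissibleSeq.comp :
    ∀ {X'' X' X : Scheme.{u}} {π' : X'' ⟶ X'} {π : X' ⟶ X} {K : X.IdealSheafData} {N : ℕ}
      {K' : X'.IdealSheafData} {K'' : X''.IdealSheafData},
      IsSingPermissibleSeq π' K' N K'' → IsSingPermissibleSeq π K N K' →
        IsSingPermissibleSeq (π' ≫ π) K N K'' := by
  intro X'' X' X π' π K N K' K'' h
  induction h with
  | nil K' N => intro h0; rwa [Category.id_comp]
  | @cons X₃ X₂ X₁ τ π₂ K₂ N K₂' Y hπ₂ hYint hYreg hY hτ ih =>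
    intro h0
    have := IsSingPermissibleSeq.cons τ (π₂ ≫ π) K N K₂' Y (ih h0) hYint hYreg hY hτ
    rwa [Category.assoc]

/-- [OURS · L1 W5.2] **[CoP1] Prop. 4.4 at markings `≥ N` only** (the child phases use nothing else;
instance of the tree fact, `prop44From_of_prop44`).  NOT a statement of the manuscript. [conjecture] -/
def Prop44From (N : ℕ) (S : Scheme.{u}) (I : S.IdealSheafData) : Prop :=
  ∀ (X : Scheme.{u}) (ρ : X ⟶ S) [IsIntegral X] [IsNoetherian X],
    IsRegularCentreBlowupSeq ρ I → ∀ (J : X.IdealSheafData) (μ : ℕ), N ≤ μ →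
      (∀ x ∈ J.support, 1 < Order.coheight x) → (∀ x, idealOrder J x ≤ μ) →
      (∃ x, idealOrder J x = μ) →
      ∃ (X' : Scheme.{u}) (π : X' ⟶ X) (J' : X'.IdealSheafData),
        IsPermissibleSeq π J μ J' ∧ ∀ x, idealOrder J' x < μ

/-- `Prop44From N` (`N ≥ 1`) is an instance of the tree fact `CossartPiltant2008_prop44`. PROVED.
[folklore] -/
theorem prop44From_of_prop44 (h44 : CossartPiltant2008_prop44.{u}) {N : ℕ} (hN : 1 ≤ N)
    (S : Scheme.{u}) [IsIntegral S] [IsNoetherian S] (hreg : Scheme.IsRegular S)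
    (hexc : Scheme.IsExcellent S) (hdim : topologicalKrullDim S = 3) (I : S.IdealSheafData)
    (hI : I ≠ ⊥) : Prop44From N S I := by
  intro X ρ _ _ hρ J μ hμ hcoh hle hex
  exact h44 S hreg hexc hdim I hI X ρ hρ J μ (by omega) hcoh hle hex

/-- [OURS · L1 W5.2] **Child cascade** (bookkeeping of the CHILD phases for the marking `N`):
composites of blowing ups along regular integral centres `Y ⊆ {ord J = μ}`, `μ ≥ N`, `J` the iterated
weak transform, FLAG/MONOMIAL divisor law `D' = D𝒪 · 𝓘_exc^{μ-N}` (so that the weight-`N` transform of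
`D · J` is `D' · J'`); start `D := H`, the divisorial part of `I = H · J`.  Sketch v4's `IsFlagCascade`
with `2 ↦ N`.  NOT a statement of the manuscript. [conjecture] -/
inductive IsChildCascade (N : ℕ) (S : Scheme.{u}) (I : S.IdealSheafData) :
    ∀ {X : Scheme.{u}}, (X ⟶ S) → X.IdealSheafData → X.IdealSheafData → Prop
  /-- start: the divisorial decomposition `I = H · J`, `D := H` -/
  | start (H J : S.IdealSheafData) : IsEffectiveCartier H → H * J = I →
      (∀ x ∈ J.support, 1 < Order.coheight x) → IsChildCascade N S I (𝟙 S) H J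
  /-- one blowing up along a regular integral centre inside `{ord J = μ}`, `μ ≥ N` -/
  | step {X' X : Scheme.{u}} (ρ : X ⟶ S) (D J : X.IdealSheafData) (τ : X' ⟶ X) (Y : Closeds X)
      (μ : ℕ) : IsChildCascade N S I ρ D J → N ≤ μ →
      IsIntegral (vanishingIdeal Y).subscheme → Scheme.IsRegular (vanishingIdeal Y).subscheme →
      (∀ y ∈ (Y : Set X), idealOrder J y = μ) → IsBlowup τ (vanishingIdeal Y) →
      IsChildCascade N S I (τ ≫ ρ) (D.comap τ * (vanishingIdeal Y).comap τ ^ (μ - N))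
        (controlledTransform τ (vanishingIdeal Y) J μ)

/-- A permissible sequence of the tree at marking `μ ≥ N` extends a child cascade. PROVED. [folklore] -/
theorem IsChildCascade.append {N : ℕ} {S : Scheme.{u}} {I : S.IdealSheafData} :
    ∀ {X' X : Scheme.{u}} {π : X' ⟶ X} {J : X.IdealSheafData} {μ : ℕ} {J' : X'.IdealSheafData},
      IsPermissibleSeq π J μ J' → N ≤ μ → ∀ (ρ : X ⟶ S) (D : X.IdealSheafData),
        IsChildCascade N S I ρ D J → ∃ D' : X'.IdealSheafData, IsChildCascade N S I (π ≫ ρ) D' J' := by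
  intro X' X π J μ J' h
  induction h with
  | nil J μ =>
    intro _ ρ D hc
    exact ⟨D, by rwa [Category.id_comp]⟩
  | @cons X'' X' X τ π J μ J' Y hπ hYint hYreg hY hτ ih =>
    intro hμ ρ D hc
    obtain ⟨D', hc'⟩ := ih hμ ρ D hc
    refine ⟨D'.comap τ * (vanishingIdeal Y).comap τ ^ (μ - N), ?_⟩
    rw [Category.assoc]
    exact IsChildCascade.step (π ≫ ρ) D' J' τ Y μ hc' hμ hYint hYreg hY hτ

/-- The child-cascade divisor is effective Cartier. PROVED. [folklore] -/
theorem IsChildCascade.isEffectiveCartier {N : ℕ} {S : Scheme.{u}} {I : S.IdealSheafData} :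
    ∀ {X : Scheme.{u}} {ρ : X ⟶ S} {D J : X.IdealSheafData}, IsChildCascade N S I ρ D J →
      IsEffectiveCartier D := by
  intro X ρ D J h
  induction h with
  | start H J hH hHJ hcoh => exact hH
  | step ρ D J τ Y μ hc hμ hYint hYreg hY hτ ih =>
    exact (ih.comap_of_isBlowup hτ).mul (hτ.isEffectiveCartier.pow (μ - N))

/-- [OURS · L1 W5.2] **THEOREM C6-A₀ (child cascade for every marking `N ≥ 1`; PROVED modulo
`Prop44From N` = the tree fact).**  For `I ≠ 0` on a regular excellent integral Noetherian threefold `S`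
there is a child cascade ending with `I𝒪 = H · J`, `H`, `D` effective Cartier, `codim V(J) ≥ 2` and
`ord_x J < N` for EVERY `x` — i.e. the child half `INV(N-1).1` of the cascade invariant.  Proof = the
tree's induction of `exists_principalization_of_prop44` ([CoP1] p. 8) stopped at the bound `N - 1`
(Sketch v4 `exists_flagCascade_to_order_one` is the case `N = 2`).  NOT a statement of the manuscript. -/
theorem exists_childCascade {N : ℕ} (hN : 1 ≤ N) (S : Scheme.{u}) [IsIntegral S] [IsNoetherian S]
    (hreg : Scheme.IsRegular S) (hexc : Scheme.IsExcellent S) (I : S.IdealSheafData) (hI : I ≠ ⊥)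
    (h44 : Prop44From N S I) :
    ∃ (X : Scheme.{u}) (_ : IsIntegral X) (_ : IsNoetherian X) (ρ : X ⟶ S)
      (H D J : X.IdealSheafData), IsChildCascade N S I ρ D J ∧ IsRegularCentreBlowupSeq ρ I ∧
      IsEffectiveCartier H ∧ IsEffectiveCartier D ∧ I.comap ρ = H * J ∧
      (∀ x ∈ J.support, 1 < Order.coheight x) ∧ ∀ x, idealOrder J x < (N : ℕ∞) := by
  -- the claim, by induction on a bound `m + (N - 1)` for the order of `J` (stopped at `N - 1`)
  have claim : ∀ (m : ℕ) (X : Scheme.{u}) (ρ : X ⟶ S) (H D J : X.IdealSheafData)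
      [IsIntegral X] [IsNoetherian X], IsChildCascade N S I ρ D J → IsRegularCentreBlowupSeq ρ I →
      IsEffectiveCartier H → I.comap ρ = H * J → (∀ x ∈ J.support, 1 < Order.coheight x) →
      (∀ x, idealOrder J x ≤ ((m + (N - 1) : ℕ) : ℕ∞)) →
      ∃ (X : Scheme.{u}) (_ : IsIntegral X) (_ : IsNoetherian X) (ρ : X ⟶ S)
        (H D J : X.IdealSheafData), IsChildCascade N S I ρ D J ∧ IsRegularCentreBlowupSeq ρ I ∧
        IsEffectiveCartier H ∧ IsEffectiveCartier D ∧ I.comap ρ = H * J ∧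
        (∀ x ∈ J.support, 1 < Order.coheight x) ∧ ∀ x, idealOrder J x < (N : ℕ∞) := by
    intro m
    induction m with
    | zero =>
      intro X ρ H D J _ _ hc hρ hH hfac hJ hbd
      refine ⟨X, inferInstance, inferInstance, ρ, H, D, J, hc, hρ, hH, hc.isEffectiveCartier, hfac, hJ,
        fun x => ?_⟩
      have := hbd x
      have h' : (((0 + (N - 1) : ℕ)) : ℕ∞) < (N : ℕ∞) := by exact_mod_cast (by omega : 0 + (N - 1) < N)
      exact lt_of_le_of_lt this h'
    | succ m ih =>
      intro X ρ H D J _ _ hc hρ hH hfac hJ hbd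
      by_cases hall : ∀ x, idealOrder J x ≤ ((m + (N - 1) : ℕ) : ℕ∞)
      · exact ih X ρ H D J hc hρ hH hfac hJ hall
      push Not at hall
      obtain ⟨x₀, hx₀⟩ := hall
      have hx₀' : idealOrder J x₀ = ((m + 1 + (N - 1) : ℕ) : ℕ∞) := by
        refine le_antisymm (hbd x₀) ?_
        have := Order.add_one_le_of_lt hx₀
        have e : m + 1 + (N - 1) = m + (N - 1) + 1 := by omega
        rw [e]
        exact_mod_cast this
      -- Prop. 4.4 for `(J, m + N)` on the stage `X` (marking `≥ N`)
      obtain ⟨X', π, J', hπ, hJ'⟩ :=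
        h44 X ρ hρ J (m + 1 + (N - 1)) (by omega) hJ hbd ⟨x₀, hx₀'⟩
      obtain ⟨hint', hnoeth', hρ', H', hH', hfac', hJ'coh⟩ :=
        hπ.transport hreg I (by omega) ρ H inferInstance inferInstance hρ hH hfac hJ
      haveI := hint'
      haveI := hnoeth'
      obtain ⟨D', hc'⟩ := IsChildCascade.append hπ (by omega) ρ D hc
      refine ih X' (π ≫ ρ) H' D' J' hc' hρ' hH' hfac' hJ'coh fun x => ?_
      have := hJ' x
      have e : m + 1 + (N - 1) = m + (N - 1) + 1 := by omega
      rw [e] at this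
      push_cast at this ⊢
      exact Order.le_of_lt_add_one this
  obtain ⟨H, J, hH, hHJ, -, -, hJcoh⟩ := exists_divisorial_decomposition hreg hI
  have hJ0 : J ≠ ⊥ := ne_bot_of_forall_one_lt_coheight hJcoh
  obtain ⟨M, hM⟩ := exists_forall_idealOrder_lt hreg hexc hJ0
  exact claim M S (𝟙 S) H H J (IsChildCascade.start H J hH hHJ hJcoh) (IsRegularCentreBlowupSeq.nil I)
    hH (by rw [Scheme.IdealSheafData.comap_id, hHJ]) hJcoh
    fun x => (hM x).le.trans (by exact_mod_cast (by omega : M ≤ M + (N - 1)))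

/-! ## §5 The companion phases: ONE `μ`-step (typed target) and its ITERATION (proved) -/

/-- [OURS · L1 W5.2] **Stage data** carried by the cascade on a Cossart–Piltant stage `ρ : X → S` of
`I`: `I𝒪_X = M · J` with `M` (all divisorial weight) and the flag/monomial divisor `D` effective Cartier,
`codim V(J) ≥ 2`.  NOT a statement of the manuscript. [conjecture] -/
def StageData (S : Scheme.{u}) (I : S.IdealSheafData) (X : Scheme.{u}) (ρ : X ⟶ S)
    (M D J : X.IdealSheafData) : Prop :=
  IsRegularCentreBlowupSeq ρ I ∧ IsEffectiveCartier M ∧ IsEffectiveCartier D ∧ I.comap ρ = M * J ∧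
    ∀ x ∈ J.support, 1 < Order.coheight x

/-- [OURS · L1 W5.2] **TARGET C6-A (companion descent, one level).**  On every Cossart–Piltant stage of
`I ≠ 0` over a regular excellent integral Noetherian THREEFOLD `S`, for `1 ≤ μ < N` and stage data
`(M, D, J)` satisfying `INV(μ)`: there is a Σ-permissible sequence for `(D · J, N)` (so: X-permissible at
weight `ℓ`, §3) ending with stage data `(M', D', J')` satisfying `INV(μ - 1)`.  PROOF SKETCH (size M, not
in this file): if `Sing(O_μ) = ∅` take the empty sequence; else [CoP1] Prop. 4.4 (tree fact
`CossartPiltant2008_prop44`) applies to the companion `O_μ` on the stage (`codim V(O_μ) ≥ 2` since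
`V(O_μ) ⊆ V(J)`; `ord ≤ μ(N-μ)` everywhere by `idealOrder_companion_le`; `= μ(N-μ)` on `Sing(O_μ)`);
transport along its permissible sequence with `transform_companion` / `transform_stripped`, Giraud
(`IsBlowup.idealOrder_controlledTransform_le_of_mem`, the centre having `ord J = μ` by
`idealOrder_eq_of_mem_support_companion`), off-centre invariance
(`IsBlowup.idealOrder_controlledTransform_of_not_mem`), the stage property
(`not_isLocallyPrincipalAt_mul_of_forall_one_lt_coheight`: centres lie in `V(J)`) and codimension
(`IsBlowup.one_lt_coheight_of_mem_support_controlledTransform`) — the pattern of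
`IsPermissibleSeq.transport`; the output `ord O' < μ(N-μ)` everywhere is `Sing(O'_μ) = ∅`, i.e.
`INV(μ-1)`.  NOT a statement of the manuscript; OURS, OPEN (typing target). [conjecture] -/
def CompanionDescent : Prop :=
  ∀ (S : Scheme.{u}) [IsIntegral S] [IsNoetherian S], Scheme.IsRegular S → Scheme.IsExcellent S →
    topologicalKrullDim S = 3 → ∀ (I : S.IdealSheafData), I ≠ ⊥ →
    ∀ (X : Scheme.{u}) (ρ : X ⟶ S) [IsIntegral X] [IsNoetherian X] (M D J : X.IdealSheafData)
      (N μ : ℕ), StageData S I X ρ M D J → 1 ≤ μ → μ < N → NoStratumAbove D J N μ →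
      ∃ (X' : Scheme.{u}) (_ : IsIntegral X') (_ : IsNoetherian X') (π : X' ⟶ X)
        (M' D' J' : X'.IdealSheafData),
        IsSingPermissibleSeq π (D * J) N (D' * J') ∧ StageData S I X' (π ≫ ρ) M' D' J' ∧
          NoStratumAbove D' J' N (μ - 1)

/-- [OURS · L1 W5.2] **THEOREM C6-A⁺ (the companion cascade; PROVED from `CompanionDescent` by
induction on `μ = N-1, …, 1`).**  From stage data with `INV(N-1)` (= the output of the child cascade,
`exists_childCascade`) one reaches, by a Σ-permissible (hence X-permissible) sequence for `(D · J, N)`,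
stage data with `INV(0)`: `ord J' < N` everywhere and `ord_x J' ≥ μ' ⇒ ord_x D' < N - μ'` for EVERY
`1 ≤ μ' < N` — the MONOMIAL × UNIT end state handed to Kollár's (3.111) Step 3 (tree theorem
`exists_isResolutionOf_monomialTimes`, via the valuative identity `ord(D·J) = ord D + ord J`, tree
`idealOrder_mul_of_span_singleton`, and an snc presentation of `D`, which is where `Prop44B` enters).
NOT a statement of the manuscript. -/
theorem companionCascade_of_descent (hdesc : CompanionDescent.{u}) (S : Scheme.{u}) [IsIntegral S]
    [IsNoetherian S] (hreg : Scheme.IsRegular S) (hexc : Scheme.IsExcellent S)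
    (hdim : topologicalKrullDim S = 3) (I : S.IdealSheafData) (hI : I ≠ ⊥) {N : ℕ} (_hN : 1 ≤ N) :
    ∀ (k : ℕ) (X : Scheme.{u}) (ρ : X ⟶ S) [IsIntegral X] [IsNoetherian X] (M D J : X.IdealSheafData),
      StageData S I X ρ M D J → k < N → NoStratumAbove D J N k →
      ∃ (X' : Scheme.{u}) (_ : IsIntegral X') (_ : IsNoetherian X') (π : X' ⟶ X)
        (M' D' J' : X'.IdealSheafData),
        IsSingPermissibleSeq π (D * J) N (D' * J') ∧ StageData S I X' (π ≫ ρ) M' D' J' ∧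
          NoStratumAbove D' J' N 0 := by
  intro k
  induction k with
  | zero =>
    intro X ρ _ _ M D J hst _ hinv
    exact ⟨X, inferInstance, inferInstance, 𝟙 X, M, D, J, IsSingPermissibleSeq.nil _ _,
      by rwa [Category.id_comp], hinv⟩
  | succ k ih =>
    intro X ρ _ _ M D J hst hk hinv
    obtain ⟨X', hint', hnoeth', π, M', D', J', hπ, hst', hinv'⟩ :=
      hdesc S hreg hexc hdim I hI X ρ M D J N (k + 1) hst (by omega) hk hinv
    haveI := hint'
    haveI := hnoeth'
    have hinv'' : NoStratumAbove D' J' N k := by simpa using hinv'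
    obtain ⟨X'', hint'', hnoeth'', π', M'', D'', J'', hπ', hst'', hinv0⟩ :=
      ih X' (π ≫ ρ) M' D' J' hst' (by omega) hinv''
    exact ⟨X'', hint'', hnoeth'', π' ≫ π, M'', D'', J'', hπ'.comp hπ, by rwa [Category.assoc], hinv0⟩


end DepthCascade

end Summit.ResolutionOfSingularities.ResolutionOfSingularities.Theorems

end
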